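import Literature.Computability.Complexity.CRRRank
import Mathlib.Data.Nat.Prime.Nth
import HarnessLib

/-!
# Blocks of primes by index and one level of the exact-halving formula (arithmetic)

Pure arithmetic (theorems only) completing `CRRRank` for the conversion from Chinese remainder
representation to binary inside the counting hierarchy (Hesse–Allender–Barrington, JCSS 65
(2002), proof of Thm. 4.1; Bürgisser, ECCC TR06-113, Thm. 3.4):

* the sets `P(N; a, b)` of primes `q < N` with index `#{primes < q} ∈ [a, b)`: as images of
  `Nat.nth Nat.Prime` (`primeIdxSet_eq_image`), their cardinality `b - a` (`card_primeIdxSet`),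
  the lower bound `5^{b-a} ≤ ∏ P(N; a, b)` for `a ≥ 2` (`pow_le_prod_primeIdxSet`), parity and
  coprimality to `3` of the products, and the splitting `∏ P(N; a, c) = ∏ P(N; a, b) · ∏ P(N; b, c)`
  (`prod_primeIdxSet_mul`) with its iterate over consecutive blocks (`prod_blocks_eq`) — the
  auxiliary moduli "`Aᵢ = ∏_{j=1}^{k} p_{ik+j}`" of HAB;
* a supply of short primes, `2ᵃ ≤ #{primes < 4ᵃ}` for `a ≥ 3` (`two_pow_le_count_prime`, from the
  elementary Chebyshev bound `CRRFacts.two_pow_le_mul_primeCounting`);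
* `two_pow_mul_prod_half_eq`: `2ˢ ∏ (fᵢ+1)/2 = ∏ (fᵢ+1)` for odd `fᵢ`;
* **one level of the halving formula** (`div_two_pow_mod_three_eq`): for a set `S` of primes
  coprime to `3` split into blocks `f₀, …, f_{s-1}` (odd, `≥ A`, `2s ≤ A`, `2sX < A`) and cofactor
  inverses `h_q`, the residue `⌊X/2ˢ⌋ mod 3` equals an explicit expression in `Y mod 3`,
  `C mod 3`, `B mod 3` and the rank `C / B`, where `Y = X · ∏ (fᵢ+1)/2`, `B = ∏ S` and
  `C = ∑_q (Y mod q) h_q (B/q)` — combining `div_prod_eq_div_two_pow`, `div_mod_eq_of_mod`,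
  `mod_prod_eq_crrSum_sub`; together with `crrSum_div_le` (the rank is small),
  `sum_mul_mod_eq` and `testBit_eq_decide_div_mod_three` this is everything the `CH` assembly needs.

## References

* W. Hesse, E. Allender, D. A. M. Barrington, JCSS 65 (2002), §4, Thm. 4.1.
* P. Bürgisser, ECCC TR06-113 (2006), Thm. 3.4.
-/

namespace Literature.Computability.Complexity

open Finset Nat

/-! ### Sets of primes by index -/

section PrimeIdx

/-- Membership in the set of primes `q < N` with index in `[a, b)`. [folklore] -/
theorem mem_primeIdxSet {N a b q : ℕ} :
    q ∈ (range N).filter (fun q => q.Prime ∧ a ≤ Nat.count Nat.Prime q ∧ Nat.count Nat.Prime q < b) ↔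
      q < N ∧ q.Prime ∧ a ≤ Nat.count Nat.Prime q ∧ Nat.count Nat.Prime q < b := by
  simp only [Finset.mem_filter, Finset.mem_range]

/-- **Primes by index are values of `nth`**: if `#{primes < N} ≥ b` then the primes `q < N` with
index in `[a, b)` are exactly `nth Prime k`, `k ∈ [a, b)`. [folklore] -/
theorem primeIdxSet_eq_image {N a b : ℕ} (hN : b ≤ Nat.count Nat.Prime N) :
    (range N).filter (fun q => q.Prime ∧ a ≤ Nat.count Nat.Prime q ∧ Nat.count Nat.Prime q < b) =
      (Finset.Ico a b).image (Nat.nth Nat.Prime) := by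
  ext q
  rw [mem_primeIdxSet, Finset.mem_image]
  constructor
  · rintro ⟨-, hq, ha, hb⟩
    exact ⟨Nat.count Nat.Prime q, Finset.mem_Ico.2 ⟨ha, hb⟩, Nat.nth_count hq⟩
  · rintro ⟨k, hk, rfl⟩
    rw [Finset.mem_Ico] at hk
    rw [Nat.count_nth_of_infinite Nat.infinite_setOf_prime]
    exact ⟨Nat.nth_lt_of_lt_count (lt_of_lt_of_le hk.2 hN), Nat.nth_mem_of_infinite Nat.infinite_setOf_prime k, hk.1, hk.2⟩

/-- Such a block has exactly `b - a` primes. [folklore] -/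
theorem card_primeIdxSet {N a b : ℕ} (hN : b ≤ Nat.count Nat.Prime N) :
    ((range N).filter (fun q => q.Prime ∧ a ≤ Nat.count Nat.Prime q ∧ Nat.count Nat.Prime q < b)).card = b - a := by
  rw [primeIdxSet_eq_image hN, Finset.card_image_of_injective _ (Nat.nth_injective Nat.infinite_setOf_prime), Nat.card_Ico]

/-- `nth Prime 2 = 5`. [folklore] -/
theorem nth_prime_two_eq_five : Nat.nth Nat.Prime 2 = 5 := by
  have h : Nat.count Nat.Prime 5 = 2 := by decide
  rw [← h]; exact Nat.nth_count Nat.prime_five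

/-- Primes of index `≥ 2` are `≥ 5`. [folklore] -/
theorem five_le_of_two_le_count {q : ℕ} (hq : q.Prime) (h2 : 2 ≤ Nat.count Nat.Prime q) : 5 ≤ q := by
  rw [← nth_prime_two_eq_five, ← Nat.nth_count hq]
  exact (Nat.nth_le_nth Nat.infinite_setOf_prime).2 h2

/-- **Blocks are large**: `5^{b-a} ≤ ∏ P(N; a, b)` when `a ≥ 2` and the primes exist below `N`. [cite: HesseAllenderBarrington2002, Theorem 4.1] -/
theorem pow_le_prod_primeIdxSet {N a b : ℕ} (hN : b ≤ Nat.count Nat.Prime N) (ha : 2 ≤ a) :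
    5 ^ (b - a) ≤ ∏ q ∈ (range N).filter (fun q => q.Prime ∧ a ≤ Nat.count Nat.Prime q ∧ Nat.count Nat.Prime q < b), q := by
  rw [← card_primeIdxSet hN, ← Finset.prod_const]
  refine Finset.prod_le_prod' fun q hq => ?_
  rw [mem_primeIdxSet] at hq
  exact five_le_of_two_le_count hq.2.1 (ha.trans hq.2.2.1)

/-- Products of primes of index `≥ 2` are odd. [folklore] -/
theorem prod_primeIdxSet_mod_two {N a b : ℕ} (ha : 2 ≤ a) :
    (∏ q ∈ (range N).filter (fun q => q.Prime ∧ a ≤ Nat.count Nat.Prime q ∧ Nat.count Nat.Prime q < b), q) % 2 = 1 := by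
  rw [Finset.prod_nat_mod]
  have h1 : ∀ q ∈ (range N).filter (fun q => q.Prime ∧ a ≤ Nat.count Nat.Prime q ∧ Nat.count Nat.Prime q < b), q % 2 = 1 := by
    intro q hq
    rw [mem_primeIdxSet] at hq
    rcases hq.2.1.eq_two_or_odd with h | h
    · have := five_le_of_two_le_count hq.2.1 (ha.trans hq.2.2.1); omega
    · exact h
  rw [Finset.prod_congr rfl h1, Finset.prod_const_one]
  norm_num

/-- Products of primes of index `≥ 2` are coprime to `3`. [folklore] -/
theorem prod_primeIdxSet_mod_three_ne_zero {N a b : ℕ} (ha : 2 ≤ a) :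
    (∏ q ∈ (range N).filter (fun q => q.Prime ∧ a ≤ Nat.count Nat.Prime q ∧ Nat.count Nat.Prime q < b), q) % 3 ≠ 0 := by
  intro h
  have h3 : (3 : ℕ) ∣ ∏ q ∈ (range N).filter (fun q => q.Prime ∧ a ≤ Nat.count Nat.Prime q ∧ Nat.count Nat.Prime q < b), q :=
    Nat.dvd_of_mod_eq_zero h
  rcases (Prime.dvd_finsetProd_iff Nat.prime_three.prime _).1 h3 with ⟨q, hq, hdvd⟩
  rw [mem_primeIdxSet] at hq
  have h5 := five_le_of_two_le_count hq.2.1 (ha.trans hq.2.2.1)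
  have := (Nat.prime_dvd_prime_iff_eq Nat.prime_three hq.2.1).1 hdvd
  omega

/-- **Splitting a range of indices**: `∏ P(N; a, c) = ∏ P(N; a, b) · ∏ P(N; b, c)` for `a ≤ b ≤ c`. [folklore] -/
theorem prod_primeIdxSet_mul {N a b c : ℕ} (hab : a ≤ b) (hbc : b ≤ c) :
    (∏ q ∈ (range N).filter (fun q => q.Prime ∧ a ≤ Nat.count Nat.Prime q ∧ Nat.count Nat.Prime q < b), q) *
      (∏ q ∈ (range N).filter (fun q => q.Prime ∧ b ≤ Nat.count Nat.Prime q ∧ Nat.count Nat.Prime q < c), q) =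
      ∏ q ∈ (range N).filter (fun q => q.Prime ∧ a ≤ Nat.count Nat.Prime q ∧ Nat.count Nat.Prime q < c), q := by
  rw [← Finset.prod_union]
  · refine Finset.prod_congr ?_ fun _ _ => rfl
    ext q
    simp only [Finset.mem_union, mem_primeIdxSet]
    constructor
    · rintro (⟨h1, h2, h3, h4⟩ | ⟨h1, h2, h3, h4⟩)
      · exact ⟨h1, h2, h3, lt_of_lt_of_le h4 hbc⟩
      · exact ⟨h1, h2, hab.trans h3, h4⟩
    · rintro ⟨h1, h2, h3, h4⟩
      by_cases hb : Nat.count Nat.Prime q < b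
      · exact Or.inl ⟨h1, h2, h3, hb⟩
      · exact Or.inr ⟨h1, h2, not_lt.1 hb, h4⟩
  · rw [Finset.disjoint_left]
    intro q h1 h2
    rw [mem_primeIdxSet] at h1 h2
    omega

/-- **Consecutive blocks multiply to the whole range**:
`∏_{i<s} ∏ P(N; lo + L i, lo + L (i+1)) = ∏ P(N; lo, lo + L s)`. [cite: HesseAllenderBarrington2002, Theorem 4.1] -/
theorem prod_blocks_eq (N lo L : ℕ) : ∀ s : ℕ,
    ∏ i ∈ range s, (∏ q ∈ (range N).filter (fun q => q.Prime ∧ lo + L * i ≤ Nat.count Nat.Prime q ∧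
        Nat.count Nat.Prime q < lo + L * (i + 1)), q) =
      ∏ q ∈ (range N).filter (fun q => q.Prime ∧ lo ≤ Nat.count Nat.Prime q ∧ Nat.count Nat.Prime q < lo + L * s), q
  | 0 => by
    rw [Finset.prod_range_zero, mul_zero, add_zero]
    symm
    refine Finset.prod_eq_one fun q hq => ?_
    rw [mem_primeIdxSet] at hq
    omega
  | s + 1 => by
    rw [Finset.prod_range_succ, prod_blocks_eq N lo L s,
      prod_primeIdxSet_mul (Nat.le_add_right _ _) (by nlinarith)]

end PrimeIdx

/-! ### Supply of short primes -/

/-- **Enough short primes**: `2ᵃ ≤ #{primes < 4ᵃ}` for `a ≥ 3` (from `2ᵗ ≤ t π(2ᵗ) + t + 1`). [folklore] -/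
theorem two_pow_le_count_prime (a : ℕ) (ha : 3 ≤ a) : 2 ^ a ≤ Nat.count Nat.Prime (4 ^ a) := by
  -- `2a + 2 ≤ 2^a` for `a ≥ 3`
  have h2a : 2 * a + 2 ≤ 2 ^ a := by
    induction a, ha using Nat.le_induction with
    | base => norm_num
    | succ n hn ih => rw [pow_succ]; omega
  have h := two_pow_le_mul_primeCounting (2 * a)
  have h4 : (2 : ℕ) ^ (2 * a) = 4 ^ a := by rw [pow_mul]; norm_num
  rw [h4] at h
  -- `π(4^a) = #{primes < 4^a}` since `4^a` is not prime
  have hnp : ¬ (4 ^ a).Prime := by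
    intro hp
    have h2 : 2 ∣ 4 ^ a := (show (2 : ℕ) ∣ 4 by norm_num).trans (dvd_pow_self 4 (by omega))
    have := (Nat.prime_dvd_prime_iff_eq Nat.prime_two hp).1 h2
    have : 4 ≤ 4 ^ a := Nat.le_self_pow (by omega) 4
    omega
  have hpc : Nat.primeCounting (4 ^ a) = Nat.count Nat.Prime (4 ^ a) := by
    rw [Nat.primeCounting, Nat.primeCounting', Nat.count_succ, if_neg hnp, add_zero]
  rw [hpc] at h
  -- `4^a ≥ 2^a (2a + 2)`
  have h4a : 2 ^ a * (2 * a + 2) ≤ 4 ^ a := by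
    have : (4 : ℕ) ^ a = 2 ^ a * 2 ^ a := by rw [← h4, two_mul, pow_add]
    rw [this]; exact Nat.mul_le_mul_left _ h2a
  by_contra hlt
  rw [not_le] at hlt
  have h5 : 2 * a * Nat.count Nat.Prime (4 ^ a) + 2 * a ≤ 2 * a * 2 ^ a := by
    have h' : Nat.count Nat.Prime (4 ^ a) + 1 ≤ 2 ^ a := hlt
    calc 2 * a * Nat.count Nat.Prime (4 ^ a) + 2 * a = 2 * a * (Nat.count Nat.Prime (4 ^ a) + 1) := by ring
      _ ≤ 2 * a * 2 ^ a := Nat.mul_le_mul_left _ h'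
  have h6 : 2 * a * 2 ^ a + 1 < 2 ^ a * (2 * a + 2) := by
    have h1 : 1 ≤ 2 ^ a := Nat.one_le_two_pow
    nlinarith
  omega

/-! ### Halving data -/

/-- `2ˢ · ∏_{i<s} (fᵢ+1)/2 = ∏_{i<s} (fᵢ+1)` for odd `fᵢ`. [folklore] -/
theorem two_pow_mul_prod_half_eq (f : ℕ → ℕ) : ∀ s : ℕ, (∀ i < s, f i % 2 = 1) →
    2 ^ s * ∏ i ∈ range s, (f i + 1) / 2 = ∏ i ∈ range s, (f i + 1)
  | 0, _ => by simp
  | s + 1, hodd => by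
    rw [Finset.prod_range_succ, Finset.prod_range_succ, ← two_pow_mul_prod_half_eq f s fun i hi => hodd i (Nat.lt_succ_of_lt hi),
      pow_succ]
    have h := hodd s (Nat.lt_succ_self s)
    have h2 : (f s + 1) / 2 * 2 = f s + 1 := by omega
    calc 2 ^ s * 2 * ((∏ i ∈ range s, (f i + 1) / 2) * ((f s + 1) / 2))
        = 2 ^ s * (∏ i ∈ range s, (f i + 1) / 2) * ((f s + 1) / 2 * 2) := by ring
      _ = 2 ^ s * (∏ i ∈ range s, (f i + 1) / 2) * (f s + 1) := by rw [h2]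

/-- Sums modulo `m` only need the second factors modulo `m`. [folklore] -/
theorem sum_mul_mod_eq (S : Finset ℕ) (a b : ℕ → ℕ) (m : ℕ) :
    (∑ q ∈ S, a q * b q) % m = (∑ q ∈ S, a q * (b q % m)) % m := by
  rw [Finset.sum_nat_mod, Finset.sum_nat_mod S m (fun q => a q * (b q % m))]
  refine congrArg (· % m) (Finset.sum_congr rfl fun q _ => ?_)
  rw [Nat.mul_mod, Nat.mul_mod (a q) (b q % m), Nat.mod_mod]

/-- **The rank is small**: `C / B ≤ |S| · Q` when the residues and inverses are below `q ≤ Q`. [cite: HesseAllenderBarrington2002, §4] -/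
theorem crrSum_div_le (S : Finset ℕ) (y h : ℕ → ℕ) (Q : ℕ) (hpos : ∀ q ∈ S, 0 < q) (hy : ∀ q ∈ S, y q < q)
    (hh : ∀ q ∈ S, h q < q) (hQ : ∀ q ∈ S, q ≤ Q) :
    (∑ q ∈ S, y q * h q * ∏ r ∈ S.erase q, r) / (∏ q ∈ S, q) ≤ S.card * Q := by
  have hB : 0 < ∏ q ∈ S, q := Finset.prod_pos hpos
  rw [Nat.div_le_iff_le_mul_add_pred hB]
  have hterm : ∀ q ∈ S, y q * h q * ∏ r ∈ S.erase q, r ≤ Q * ∏ r ∈ S, r := by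
    intro q hq
    rw [← prod_erase_mul_eq S hq]
    calc y q * h q * ∏ r ∈ S.erase q, r ≤ q * q * ∏ r ∈ S.erase q, r :=
          Nat.mul_le_mul_right _ (Nat.mul_le_mul (hy q hq).le (hh q hq).le)
      _ = q * ((∏ r ∈ S.erase q, r) * q) := by ring
      _ ≤ Q * ((∏ r ∈ S.erase q, r) * q) := Nat.mul_le_mul_right _ (hQ q hq)
  calc ∑ q ∈ S, y q * h q * ∏ r ∈ S.erase q, r ≤ ∑ _q ∈ S, Q * ∏ r ∈ S, r := Finset.sum_le_sum hterm
    _ = (∏ q ∈ S, q) * (S.card * Q) := by rw [Finset.sum_const, smul_eq_mul]; ring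
    _ ≤ (∏ q ∈ S, q) * (S.card * Q) + (∏ q ∈ S, q - 1) := Nat.le_add_right _ _

/-- Sums with coefficients vanishing off `S ⊆ range N` are sums over `S`. [folklore] -/
theorem sum_range_eq_sum_of_support (N : ℕ) (S : Finset ℕ) (c g : ℕ → ℕ) (hS : S ⊆ range N) (hc : ∀ q, q ∉ S → c q = 0) :
    ∑ q ∈ range N, c q * g q = ∑ q ∈ S, c q * g q := by
  symm
  refine Finset.sum_subset hS fun q _ hq => ?_
  rw [hc q hq, zero_mul]

/-! ### One level of the halving formula -/

/-- **`⌊X/2ˢ⌋ mod 3` from Chinese remainder data** (HAB 2002, proof of Thm. 4.1, with the rank in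
place of comparisons): for a set `S` of primes coprime to `3`, split into odd blocks
`f₀ ⋯ f_{s-1} = ∏ S` with `fᵢ ≥ A`, `2s ≤ A`, `2sX < A`, and cofactor inverses `h_q`; with
`K = ∏ (fᵢ+1)/2`, `Y = XK`, `B = ∏ S`, `C = ∑_q (Y mod q) h_q (B/q)` and `rk = C / B`:
`⌊X/2ˢ⌋ mod 3 = ((Y mod 3 + 3 - ((C mod 3 + 3 - ((B mod 3) · rk) mod 3) mod 3)) · (B mod 3)) mod 3`. [cite: HesseAllenderBarrington2002, Theorem 4.1] -/
theorem div_two_pow_mod_three_eq (X s A : ℕ) (S : Finset ℕ) (f h : ℕ → ℕ)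
    (hS : ∀ q ∈ S, q.Prime) (hS3 : (∏ q ∈ S, q) % 3 ≠ 0)
    (hB : ∏ i ∈ range s, f i = ∏ q ∈ S, q) (hodd : ∀ i < s, f i % 2 = 1)
    (hf : ∀ i < s, A ≤ f i) (hs : 2 * s ≤ A) (hX : 2 * s * X < A)
    (hh : ∀ q ∈ S, h q * (∏ r ∈ S.erase q, r) % q = 1) :
    X / 2 ^ s % 3 =
      (((X * ∏ i ∈ range s, (f i + 1) / 2) % 3 + 3 -
          ((∑ q ∈ S, (X * ∏ i ∈ range s, (f i + 1) / 2) % q * h q * ∏ r ∈ S.erase q, r) % 3 + 3 -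
              (∏ q ∈ S, q) % 3 *
                ((∑ q ∈ S, (X * ∏ i ∈ range s, (f i + 1) / 2) % q * h q * ∏ r ∈ S.erase q, r) / ∏ q ∈ S, q) % 3) % 3) *
        ((∏ q ∈ S, q) % 3)) % 3 := by
  set K := ∏ i ∈ range s, (f i + 1) / 2 with hK
  set Y := X * K with hY
  set B := ∏ q ∈ S, q with hBdef
  set C := ∑ q ∈ S, Y % q * h q * ∏ r ∈ S.erase q, r with hC
  have h2K : 2 ^ s * K = ∏ i ∈ range s, (f i + 1) := two_pow_mul_prod_half_eq f s hodd
  have hQ : Y / B = X / 2 ^ s := by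
    rw [hY, ← hB]; exact div_prod_eq_div_two_pow X s A K f h2K hf hs hX
  rw [← hQ]
  have h3 : (0 : ℕ) < 3 := by norm_num
  have hinv : (B % 3) * B % 3 = 1 := by
    rw [Nat.mul_mod, Nat.mod_mod, ← Nat.mul_mod]; exact mul_self_mod_three hS3
  rw [div_mod_eq_of_mod Y B 3 (B % 3) h3 hinv]
  have hYB : Y % B = C - B * (C / B) := mod_prod_eq_crrSum_sub S hS Y h hh
  have hle : B * (C / B) ≤ C := Nat.mul_div_le C B
  rw [hYB, sub_mod_eq _ _ 3 hle h3, Nat.mul_mod B (C / B) 3]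
  conv_rhs => rw [Nat.mul_mod (B % 3) (C / B) 3, Nat.mod_mod]

/-- **The bit from two levels**: `bit_s(X) = 1 ↔ (q₀ + 6 - 2 q₁) mod 3 = 1` for `q₀ = ⌊X/2ˢ⌋ mod 3`,
`q₁ = ⌊X/2ˢ⁺¹⌋ mod 3`. [cite: HesseAllenderBarrington2002, Theorem 4.1] -/
theorem testBit_eq_true_iff_levels (X s q₀ q₁ : ℕ) (h₀ : X / 2 ^ s % 3 = q₀) (h₁ : X / 2 ^ (s + 1) % 3 = q₁) :
    X.testBit s = true ↔ (q₀ + 6 - 2 * q₁) % 3 = 1 := by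
  rw [testBit_eq_decide_div_mod_three, h₀, h₁, decide_eq_true_iff]

end Literature.Computability.Complexity
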